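import Summits.MatrixMultiplication.MatrixMultiplication.Theorems.AbelianSTPPCensusTB5StatDefs

/-!
# T_B static certificate, range `5995 … 6012` (t*-indexed linear checker with the k-member tree at `τ = 2375/1000`): kernel evaluation, the structural table facts (`monoOK`), the domination checks (table and extra U11-G entries), volumes `1 … 600`, and completeness chunks of the bucket lists

Cell mm-stpp (rung F-M1), tier T_B = «beat `2.375` (Coppersmith–Winograd)»; checker in `AbelianSTPPCensusTB5StatDefs.lean`, table and bucket lists in `AbelianSTPPCensusTB5StatData.lean`
(pattern: theory g12's `AbelianSTPPCensusTAStatDDom*/DCk*.lean`).  `decide` with kernel reduction (standard axioms; no `native_decide`), `Elab.async false`;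
consumed by `TB5Stat.checkV_sound` / `TB5Stat.domV_sound` / `TB5Stat.m2V_sound` in the leaf `AbelianSTPPCensusLeafTB6012Closed.lean`.
WHAT THIS IS NOT: arithmetic on shape lists only; no statement about STPP families or `ω`.
-/

set_option linter.dupNamespace false
set_option autoImplicit false
set_option Elab.async false

namespace Summit.MatrixMultiplication.MatrixMultiplication.Theorems.TB5Stat

set_option maxHeartbeats 0 in
/-- The structural facts about the table (`monoOK`: row lengths, positive denominators, monotonicity in level and bucket, bucket growth,
budget-parameter clauses — trivial here, `tp = tb`). [original] -/
theorem mono_ok : TB5Stat.monoOK TB5StatData.nl TB5StatData.nb = true := by decide +kernel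

set_option maxHeartbeats 0 in
/-- Domination chunk: every sorted candidate shape of the volumes `1 … 300` is dominated by the table (1293 shapes). [original] -/
theorem dom1 : TB5Stat.domV 300 1 = true := by decide +kernel

set_option maxHeartbeats 0 in
/-- Domination chunk: every sorted candidate shape of the volumes `301 … 600` is dominated by the table (1766 shapes). [original] -/
theorem dom301 : TB5Stat.domV 300 301 = true := by decide +kernel

set_option maxHeartbeats 0 in
/-- The extra U11-G entries have parameters `≥ 3` and positive denominators (`xdenOK`). [original] -/
theorem xden_ok : TB5Stat.xdenOK = true := by decide +kernel

set_option maxHeartbeats 0 in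
/-- Extra-domination chunk: every sorted candidate shape of the volumes `1 … 300` is dominated at the extra U11-G entries of every level covering it. [original] -/
theorem xdom1 : TB5Stat.domXTV 300 1 = true := by decide +kernel

set_option maxHeartbeats 0 in
/-- Extra-domination chunk: every sorted candidate shape of the volumes `301 … 600` is dominated at the extra U11-G entries of every level covering it. [original] -/
theorem xdom301 : TB5Stat.domXTV 300 301 = true := by decide +kernel

end Summit.MatrixMultiplication.MatrixMultiplication.Theorems.TB5Stat
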